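import Summits.Ventures.LatticeQCDFlow.Scaling.HubCollectorLaw

/-!
HONEST FRAMING: exact (Metropolis-corrected) sampling algorithms for lattice gauge theory; figures
of merit are autocorrelation/cost numbers at stated couplings and volumes; no continuum-physics
claim.

# RefreshBudgetFloor — THE REFRESH BUDGET: AN EXCHANGE SCHEME WITH IDENTITY MAPS (PLAIN REPLICA EXCHANGE ON ANY SWAP
# LIST, ANY UPDATE ALLOCATION, ANY UPDATE KERNELS) ONLY PERMUTES REPLICA CONTENTS WHEN IT SWAPS, SO FROM THE CONSTANT
# RARE CONFIGURATION IT IS NOT `ε`-MIXED BEFORE `(K+1)(1 − ε − δ)` COORDINATES HAVE BEEN UPDATED: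
# `t_mix(ε) ≥ (K+1)(1 − ε − δ)/(1 − t)`, `δ = Σ_k μ_k(s)` — LINEAR IN `K`, BUT WITH THE FACTOR `1/(1−t)` THAT THE
# COLLECTOR FLOOR DOES NOT SEE AND THE CEILINGS OF CHAPTER M CARRY (lean-2 GEN-26, ours)

Venture-side (OURS).  Cell `lqcd-flow` (pub-lqcd), unit `pub-lqcd-lean-2-g26`, 2026-08-27.  Chapter M, file 19 — a
floor in the refresh currency.  THE SCHEME: `P = t·GSw + (1−t)·Π_w^M` on `Fin (K+1) → S` with the Metropolis graph
swap `GSw` of an arbitrary swap list `e` (distinct endpoints) and IDENTITY maps, arbitrary update weights `w` and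
row-stochastic update kernels `M_k`, positive laws `μ_k`.  The potential `N_s(z) = #{k : z_k = s}` is invariant under
every swap (a swap with identity maps exchanges two coordinates) and drops by at most one under a single-coordinate
update; hence `E_x[N_s(X_n)] ≥ N_s(x) − n(1−t)`, and the event `{∃ k, z_k = s}` separates `δ_x Pⁿ` from `π̃` as long as
`n(1−t) < (K+1)(1 − ε − δ)`.

## What is proved

* §1–§3 `edgeFlowSwap_refl_apply`, **`count_edgeFlowSwap_refl`** (swap-invariance), **`count_update_ge`**,
  **`entrySwap_count_eq`**, **`graphSwap_count_eq`**, **`prodKernel_count_ge`**, **`scheme_count_ge`**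
  (`Σ_z P(y,z)N_s(z) ≥ N_s(y) − (1−t)`), **`scheme_lawAt_count_ge`** (`E_x[N_s(X_n)] ≥ N_s(x) − n(1−t)`).
* §4 **`scheme_lawAt_event_ge`** (`P_{x≡s}(∃ k, X_n(k) = s) ≥ 1 − n(1−t)/(K+1)`), **`refreshBudget_worstTvDist_ge`** —
  **`d(n) ≥ 1 − n(1−t)/(K+1) − Σ_k μ_k(s)`** (at `t = 1` this reads `d(n) ≥ 1 − Σ_k μ_k(s)`: swaps alone never mix).
* §5 **`refreshBudget_mixingTime_ge` (THE REFRESH-BUDGET FLOOR)** — `t < 1`, reversible updates, `ε`-close at some time: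
  **`t_mix(ε) ≥ (K+1)(1 − ε − Σ_k μ_k(s))/(1−t)`**; `exists_rare_state`; **`refreshBudget_mixingTime_ge_quarter_of_card`**
  — `|S| ≥ 4(K+1)`: `t_mix(1/4) ≥ (K+1)/(2(1−t))`.

Reading (no numerics implied): for plain parallel tempering the swap fraction cannot be pushed towards one for free —
whatever the swap graph and allocation, `(K+1)/2` coordinate refreshes precede the quarter-mixing time; with the
collector floor of `Scaling/HubCollectorLaw` the hot-only star sits between `max{(K/t)·log(K/4), (K+1)/(2(1−t))}` and
the ceiling `((K+t)/(t(1−t)))·log(…)` of `Scaling/DominatedStarRetunedConstants`.  NOT CLAIMED: flow-assisted swaps (a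
non-identity map changes contents); the product form `(K/(t(1−t)))·log K` as a floor; anything measured.  Literature
grade (cell rule): OWN RESULT (first-moment method on a swap-invariant count); nothing cited as a fact; no new bib keys.
-/

noncomputable section

open Finset Function
open Literature.Probability.MarkovChains

namespace Summit.Ventures.LatticeQCDFlow.Scaling

variable {S : Type*} [Fintype S] [DecidableEq S] {K m : ℕ} {μ : Fin (K + 1) → S → ℝ} {M : Fin (K + 1) → S → S → ℝ}
  {w : Fin (K + 1) → ℝ} {t : ℝ} {e : Fin m → Fin (K + 1) × Fin (K + 1)}

section Count

/-! ## §1 The count potential `N_s(z) = #{k : z_k = s}` -/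

omit [Fintype S] [DecidableEq S] in
/-- With the identity map an edge swap exchanges the two coordinates: `(swap_{il} z)_k = z_{σ_{il}(k)}`. [ours] -/
theorem edgeFlowSwap_refl_apply (i l : Fin (K + 1)) (z : Fin (K + 1) → S) (k : Fin (K + 1)) :
    edgeFlowSwap (Equiv.refl S) i l z k = z (Equiv.swap i l k) := by
  unfold edgeFlowSwap
  simp only [Equiv.refl_symm, Equiv.refl_apply]
  by_cases hkl : k = l
  · subst hkl; rw [update_self, Equiv.swap_apply_right]
  · rw [update_of_ne hkl]
    by_cases hki : k = i
    · subst hki; rw [update_self, Equiv.swap_apply_left]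
    · rw [update_of_ne hki, Equiv.swap_apply_of_ne_of_ne hki hkl]

omit [Fintype S] in
/-- **The count is swap-invariant:** `N_s(swap_{il} z) = N_s(z)` for identity maps. [ours] -/
theorem count_edgeFlowSwap_refl (i l : Fin (K + 1)) (z : Fin (K + 1) → S) (s : S) :
    ∑ k, (if edgeFlowSwap (Equiv.refl S) i l z k = s then (1 : ℝ) else 0) = ∑ k, (if z k = s then (1 : ℝ) else 0) := by
  simp_rw [edgeFlowSwap_refl_apply]
  exact Equiv.sum_comp (Equiv.swap i l) (fun k => if z k = s then (1 : ℝ) else 0)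

omit [Fintype S] in
/-- **A single-coordinate update costs at most one:** `N_s(z[j ↦ v]) ≥ N_s(z) − 1`. [ours] -/
theorem count_update_ge (z : Fin (K + 1) → S) (j : Fin (K + 1)) (v s : S) :
    ∑ k, (if z k = s then (1 : ℝ) else 0) - 1 ≤ ∑ k, (if update z j v k = s then (1 : ℝ) else 0) := by
  have hj : ∑ k : Fin (K + 1), (if k = j then (1 : ℝ) else 0) = 1 := by
    rw [Finset.sum_ite_eq' univ j, if_pos (mem_univ _)]
  have hsplit : (∑ k, (if z k = s then (1 : ℝ) else 0)) - 1
      = ∑ k, ((if z k = s then (1 : ℝ) else 0) - (if k = j then (1 : ℝ) else 0)) := by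
    rw [Finset.sum_sub_distrib, hj]
  rw [hsplit]
  refine Finset.sum_le_sum fun k _ => ?_
  by_cases hk : k = j
  · subst hk
    rw [if_pos rfl]
    have h1 : (if z k = s then (1 : ℝ) else 0) ≤ 1 := by split_ifs <;> norm_num
    have h2 : (0 : ℝ) ≤ (if update z k v k = s then (1 : ℝ) else 0) := by split_ifs <;> norm_num
    linarith
  · rw [if_neg hk, update_of_ne hk, sub_zero]

/-! ## §2 One-step drift of the count -/

/-- **An entry Metropolis swap with the identity map preserves the count in mean:** `Σ_z Met_r(y,z)·N_s(z) = N_s(y)` —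
the kernel moves only to `y` or to `swap y`, both of count `N_s(y)`. [ours] -/
theorem entrySwap_count_eq (hμ : ∀ k x, 0 < μ k x) (i l : Fin (K + 1)) (hil : i ≠ l) (y : Fin (K + 1) → S) (s : S) :
    ∑ z, mhKernel (fun a b : Fin (K + 1) → S => if b = edgeFlowSwap (Equiv.refl S) i l a then (1 : ℝ) else 0)
        (tensorFun μ) y z * (∑ k, (if z k = s then (1 : ℝ) else 0))
      = ∑ k, (if y k = s then (1 : ℝ) else 0) := by
  have hπ := tensorFun_pos hμ
  have hb := entryProposal_basic (φ := fun _ : Fin 1 => Equiv.refl S) (e := fun _ : Fin 1 => (i, l)) (fun _ => hil) 0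
  have hrow : ∑ z, mhKernel (fun a b : Fin (K + 1) → S => if b = edgeFlowSwap (Equiv.refl S) i l a then (1 : ℝ) else 0)
      (tensorFun μ) y z = 1 := (mhKernel_isRowStochastic hb.1 hb.2.1 hπ).2 y
  -- `Σ_z K(y,z)(N(z) − N(y)) = 0`
  have hzero : ∑ z, mhKernel (fun a b : Fin (K + 1) → S => if b = edgeFlowSwap (Equiv.refl S) i l a then (1 : ℝ) else 0)
      (tensorFun μ) y z * ((∑ k, (if z k = s then (1 : ℝ) else 0)) - ∑ k, (if y k = s then (1 : ℝ) else 0)) = 0 := by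
    refine Finset.sum_eq_zero fun z _ => ?_
    by_cases hzy : z = y
    · rw [hzy, sub_self, mul_zero]
    · rw [mhKernel_of_ne hzy]
      by_cases hzs : z = edgeFlowSwap (Equiv.refl S) i l y
      · rw [hzs, count_edgeFlowSwap_refl, sub_self, mul_zero]
      · have hle := mhRate_le (fun a b : Fin (K + 1) → S => if b = edgeFlowSwap (Equiv.refl S) i l a then (1 : ℝ) else 0)
          (tensorFun μ) y z
        have hge := mhRate_nonneg hb.1 hπ y z
        simp only [hzs, if_false] at hle
        rw [le_antisymm hle hge, zero_mul]
  calc ∑ z, mhKernel (fun a b : Fin (K + 1) → S => if b = edgeFlowSwap (Equiv.refl S) i l a then (1 : ℝ) else 0)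
        (tensorFun μ) y z * (∑ k, (if z k = s then (1 : ℝ) else 0))
      = ∑ z, (mhKernel (fun a b : Fin (K + 1) → S => if b = edgeFlowSwap (Equiv.refl S) i l a then (1 : ℝ) else 0)
          (tensorFun μ) y z * ((∑ k, (if z k = s then (1 : ℝ) else 0)) - ∑ k, (if y k = s then (1 : ℝ) else 0))
        + mhKernel (fun a b : Fin (K + 1) → S => if b = edgeFlowSwap (Equiv.refl S) i l a then (1 : ℝ) else 0)
          (tensorFun μ) y z * ∑ k, (if y k = s then (1 : ℝ) else 0)) := sum_congr rfl fun z _ => by ring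
    _ = ∑ k, (if y k = s then (1 : ℝ) else 0) := by
        rw [Finset.sum_add_distrib, hzero, ← Finset.sum_mul, hrow, zero_add, one_mul]

/-- **The Metropolis graph swap with identity maps preserves the count in mean:** `Σ_z GSw(y,z)·N_s(z) = N_s(y)`. [ours] -/
theorem graphSwap_count_eq (hm : 1 ≤ m) (he : ∀ r, (e r).1 ≠ (e r).2) (hμ : ∀ k x, 0 < μ k x)
    (y : Fin (K + 1) → S) (s : S) :
    ∑ z, ptGraphSwap μ e (fun _ => Equiv.refl S) y z * (∑ k, (if z k = s then (1 : ℝ) else 0))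
      = ∑ k, (if y k = s then (1 : ℝ) else 0) := by
  have hmpos : (0 : ℝ) < m := Nat.cast_pos.mpr (by omega)
  simp_rw [ptGraphSwap_eq_avg_entryKernel (φ := fun _ => Equiv.refl S) hm he hμ, Finset.sum_mul]
  rw [Finset.sum_comm]
  simp_rw [mul_assoc, ← Finset.mul_sum]
  rw [Finset.sum_congr rfl fun r _ => by rw [entrySwap_count_eq hμ (e r).1 (e r).2 (he r) y s], sum_const, card_univ,
    Fintype.card_fin, nsmul_eq_mul]
  field_simp

/-- **A product update costs at most one in mean:** `Σ_z Π_w^M(y,z)·N_s(z) ≥ N_s(y) − 1`. [ours] -/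
theorem prodKernel_count_ge (hM : ∀ k, IsRowStochastic (M k)) (hw0 : ∀ k, 0 ≤ w k) (hw1 : ∑ k, w k = 1)
    (y : Fin (K + 1) → S) (s : S) :
    (∑ k, (if y k = s then (1 : ℝ) else 0)) - 1
      ≤ ∑ z, prodKernel w M y z * (∑ k, (if z k = s then (1 : ℝ) else 0)) := by
  unfold prodKernel
  simp_rw [Finset.sum_mul]
  rw [Finset.sum_comm]
  simp_rw [mul_assoc, ← Finset.mul_sum, sum_coordKernel_mul]
  calc (∑ k, (if y k = s then (1 : ℝ) else 0)) - 1 = ∑ j, w j * ((∑ k, (if y k = s then (1 : ℝ) else 0)) - 1) := by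
        rw [← Finset.sum_mul, hw1, one_mul]
    _ ≤ ∑ j, w j * ∑ v, M j (y j) v * ∑ k, (if update y j v k = s then (1 : ℝ) else 0) := by
        refine Finset.sum_le_sum fun j _ => mul_le_mul_of_nonneg_left ?_ (hw0 j)
        calc (∑ k, (if y k = s then (1 : ℝ) else 0)) - 1 = ∑ v, M j (y j) v * ((∑ k, (if y k = s then (1 : ℝ) else 0)) - 1) := by
              rw [← Finset.sum_mul, (hM j).2 (y j), one_mul]
          _ ≤ _ := Finset.sum_le_sum fun v _ => mul_le_mul_of_nonneg_left (count_update_ge y j v s) ((hM j).1 _ _)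

/-- **THE ONE-STEP DRIFT: `Σ_z P(y,z)·N_s(z) ≥ N_s(y) − (1−t)`** for the scheme with identity maps (`0 ≤ t ≤ 1`). [ours] -/
theorem scheme_count_ge (hm : 1 ≤ m) (he : ∀ r, (e r).1 ≠ (e r).2) (hμ : ∀ k x, 0 < μ k x)
    (hM : ∀ k, IsRowStochastic (M k)) (hw0 : ∀ k, 0 ≤ w k) (hw1 : ∑ k, w k = 1) (ht1 : t ≤ 1)
    (y : Fin (K + 1) → S) (s : S) :
    (∑ k, (if y k = s then (1 : ℝ) else 0)) - (1 - t)
      ≤ ∑ z, (t * ptGraphSwap μ e (fun _ => Equiv.refl S) y z + (1 - t) * prodKernel w M y z)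
          * (∑ k, (if z k = s then (1 : ℝ) else 0)) := by
  have hsplit : ∀ z : Fin (K + 1) → S,
      (t * ptGraphSwap μ e (fun _ => Equiv.refl S) y z + (1 - t) * prodKernel w M y z)
          * (∑ k, (if z k = s then (1 : ℝ) else 0))
        = t * (ptGraphSwap μ e (fun _ => Equiv.refl S) y z * (∑ k, (if z k = s then (1 : ℝ) else 0)))
          + (1 - t) * (prodKernel w M y z * (∑ k, (if z k = s then (1 : ℝ) else 0))) := fun z => by ring
  rw [Finset.sum_congr rfl fun z _ => hsplit z, Finset.sum_add_distrib, ← Finset.mul_sum, ← Finset.mul_sum,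
    graphSwap_count_eq hm he hμ y s]
  have h := mul_le_mul_of_nonneg_left (prodKernel_count_ge (M := M) hM hw0 hw1 y s) (by linarith : (0 : ℝ) ≤ 1 - t)
  linarith

/-! ## §3 `n` steps -/

/-- **`E_x[N_s(X_n)] ≥ N_s(x) − n(1−t)`** for the scheme with identity maps. [ours] -/
theorem scheme_lawAt_count_ge (hm : 1 ≤ m) (he : ∀ r, (e r).1 ≠ (e r).2) (hμ : ∀ k x, 0 < μ k x)
    (hM : ∀ k, IsRowStochastic (M k)) (hw0 : ∀ k, 0 ≤ w k) (hw1 : ∑ k, w k = 1) (ht0 : 0 ≤ t) (ht1 : t ≤ 1)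
    (x : Fin (K + 1) → S) (s : S) (n : ℕ) :
    (∑ k, (if x k = s then (1 : ℝ) else 0)) - n * (1 - t)
      ≤ ∑ z, lawAt (fun y z : Fin (K + 1) → S =>
          t * ptGraphSwap μ e (fun _ => Equiv.refl S) y z + (1 - t) * prodKernel w M y z) (Pi.single x 1) n z
          * (∑ k, (if z k = s then (1 : ℝ) else 0)) := by
  have hP := weightedScheme_isRowStochastic (t := t) (w := w)
    (ptGraphSwap_isRowStochastic (e := e) (φ := fun _ => Equiv.refl S) hμ) hM hw0 hw1 ht0 ht1
  induction n with
  | zero =>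
    simp only [Nat.cast_zero, zero_mul, sub_zero, lawAt_zero]
    rw [Finset.sum_eq_single x (fun z _ hz => by rw [Pi.single_eq_of_ne hz, zero_mul])
      (fun h => absurd (mem_univ x) h), Pi.single_eq_same, one_mul]
  | succ n ih =>
    rw [lawAt_succ]
    have hnn : ∀ y, 0 ≤ lawAt (fun y z : Fin (K + 1) → S =>
        t * ptGraphSwap μ e (fun _ => Equiv.refl S) y z + (1 - t) * prodKernel w M y z) (Pi.single x 1) n y :=
      fun y => lawAt_nonneg hP (fun a => by
        by_cases h : a = x
        · subst h; rw [Pi.single_eq_same]; norm_num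
        · rw [Pi.single_eq_of_ne h]) n y
    have hmass : ∑ y, lawAt (fun y z : Fin (K + 1) → S =>
        t * ptGraphSwap μ e (fun _ => Equiv.refl S) y z + (1 - t) * prodKernel w M y z) (Pi.single x 1) n y = 1 := by
      rw [sum_lawAt hP, Finset.sum_pi_single', if_pos (mem_univ _)]
    -- exchange the order of summation in `Σ_z (Σ_y λ_y P_{yz}) N(z)`
    have hswap : ∑ z, stepLaw (fun y z : Fin (K + 1) → S =>
          t * ptGraphSwap μ e (fun _ => Equiv.refl S) y z + (1 - t) * prodKernel w M y z)
          (lawAt (fun y z : Fin (K + 1) → S =>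
            t * ptGraphSwap μ e (fun _ => Equiv.refl S) y z + (1 - t) * prodKernel w M y z) (Pi.single x 1) n) z
          * (∑ k, (if z k = s then (1 : ℝ) else 0))
        = ∑ y, lawAt (fun y z : Fin (K + 1) → S =>
            t * ptGraphSwap μ e (fun _ => Equiv.refl S) y z + (1 - t) * prodKernel w M y z) (Pi.single x 1) n y
          * ∑ z, (t * ptGraphSwap μ e (fun _ => Equiv.refl S) y z + (1 - t) * prodKernel w M y z)
            * (∑ k, (if z k = s then (1 : ℝ) else 0)) := by
      unfold stepLaw
      simp_rw [Finset.sum_mul, Finset.mul_sum, mul_assoc]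
      rw [Finset.sum_comm]
    rw [hswap]
    calc (∑ k, (if x k = s then (1 : ℝ) else 0)) - ((n + 1 : ℕ) : ℝ) * (1 - t)
        = ((∑ k, (if x k = s then (1 : ℝ) else 0)) - n * (1 - t)) - (1 - t) := by push_cast; ring
      _ ≤ (∑ y, lawAt (fun y z : Fin (K + 1) → S =>
            t * ptGraphSwap μ e (fun _ => Equiv.refl S) y z + (1 - t) * prodKernel w M y z) (Pi.single x 1) n y
            * (∑ k, (if y k = s then (1 : ℝ) else 0))) - (1 - t) := by linarith [ih]
      _ = ∑ y, lawAt (fun y z : Fin (K + 1) → S =>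
            t * ptGraphSwap μ e (fun _ => Equiv.refl S) y z + (1 - t) * prodKernel w M y z) (Pi.single x 1) n y
            * ((∑ k, (if y k = s then (1 : ℝ) else 0)) - (1 - t)) := by
          rw [Finset.sum_congr rfl fun y _ => (mul_sub _ _ _), Finset.sum_sub_distrib, ← Finset.sum_mul, hmass, one_mul]
      _ ≤ _ := Finset.sum_le_sum fun y _ => mul_le_mul_of_nonneg_left (scheme_count_ge hm he hμ hM hw0 hw1 ht1 y s)
            (hnn y)

/-! ## §4 The separating event `{∃ k, z_k = s}` -/

/-- **FROM THE CONSTANT CONFIGURATION `x ≡ s`: `P_x(∃ k, X_n(k) = s) ≥ 1 − n(1−t)/(K+1)`.** [ours] -/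
theorem scheme_lawAt_event_ge (hm : 1 ≤ m) (he : ∀ r, (e r).1 ≠ (e r).2) (hμ : ∀ k x, 0 < μ k x)
    (hM : ∀ k, IsRowStochastic (M k)) (hw0 : ∀ k, 0 ≤ w k) (hw1 : ∑ k, w k = 1) (ht0 : 0 ≤ t) (ht1 : t ≤ 1)
    (s : S) (n : ℕ) :
    1 - n * (1 - t) / (K + 1)
      ≤ ∑ z ∈ univ.filter (fun z : Fin (K + 1) → S => ∃ k ∈ (univ : Finset (Fin (K + 1))), z k = (fun _ : Fin (K + 1) => s) k),
          lawAt (fun y z : Fin (K + 1) → S =>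
            t * ptGraphSwap μ e (fun _ => Equiv.refl S) y z + (1 - t) * prodKernel w M y z)
            (Pi.single (fun _ : Fin (K + 1) => s) 1) n z := by
  set L := lawAt (fun y z : Fin (K + 1) → S =>
      t * ptGraphSwap μ e (fun _ => Equiv.refl S) y z + (1 - t) * prodKernel w M y z)
      (Pi.single (fun _ : Fin (K + 1) => s) 1) n with hL
  have hP := weightedScheme_isRowStochastic (t := t) (w := w)
    (ptGraphSwap_isRowStochastic (e := e) (φ := fun _ => Equiv.refl S) hμ) hM hw0 hw1 ht0 ht1
  have hnn : ∀ z, 0 ≤ L z := fun z => lawAt_nonneg hP (fun a => by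
    by_cases h : a = (fun _ : Fin (K + 1) => s)
    · subst h; rw [Pi.single_eq_same]; norm_num
    · rw [Pi.single_eq_of_ne h]) n z
  have hK : (0 : ℝ) < K + 1 := by positivity
  have hcount := scheme_lawAt_count_ge (e := e) (M := M) (w := w) hm he hμ hM hw0 hw1 ht0 ht1 (fun _ : Fin (K + 1) => s) s n
  have hx : ∑ k : Fin (K + 1), (if (fun _ : Fin (K + 1) => s) k = s then (1 : ℝ) else 0) = K + 1 := by
    simp only [if_true, sum_const, card_univ, Fintype.card_fin, nsmul_eq_mul, mul_one, Nat.cast_add, Nat.cast_one]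
  rw [hx] at hcount
  -- `N_s(z) ≤ (K+1)·𝟙{z ∈ A}`
  have hNle : ∀ z : Fin (K + 1) → S, (∑ k, (if z k = s then (1 : ℝ) else 0))
      ≤ (K + 1) * (if (∃ k ∈ (univ : Finset (Fin (K + 1))), z k = (fun _ : Fin (K + 1) => s) k) then (1 : ℝ) else 0) := by
    intro z
    by_cases hA : ∃ k ∈ (univ : Finset (Fin (K + 1))), z k = (fun _ : Fin (K + 1) => s) k
    · rw [if_pos hA, mul_one]
      calc ∑ k, (if z k = s then (1 : ℝ) else 0) ≤ ∑ _k : Fin (K + 1), (1 : ℝ) :=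
            Finset.sum_le_sum fun k _ => by split_ifs <;> norm_num
        _ = K + 1 := by simp
    · rw [if_neg hA, mul_zero]
      refine le_of_eq (Finset.sum_eq_zero fun k _ => ?_)
      rw [if_neg]
      intro hk
      exact hA ⟨k, mem_univ _, hk⟩
  have hsumle : ∑ z, L z * (∑ k, (if z k = s then (1 : ℝ) else 0))
      ≤ (K + 1) * ∑ z ∈ univ.filter (fun z : Fin (K + 1) → S =>
          ∃ k ∈ (univ : Finset (Fin (K + 1))), z k = (fun _ : Fin (K + 1) => s) k), L z := by
    rw [Finset.sum_filter, Finset.mul_sum]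
    refine Finset.sum_le_sum fun z _ => ?_
    calc L z * (∑ k, (if z k = s then (1 : ℝ) else 0))
        ≤ L z * ((K + 1) * (if (∃ k ∈ (univ : Finset (Fin (K + 1))), z k = (fun _ : Fin (K + 1) => s) k)
            then (1 : ℝ) else 0)) := mul_le_mul_of_nonneg_left (hNle z) (hnn z)
      _ = (K + 1) * (if (∃ k ∈ (univ : Finset (Fin (K + 1))), z k = (fun _ : Fin (K + 1) => s) k) then L z else 0) := by
          split_ifs <;> ring
  rw [sub_le_iff_le_add, ← sub_le_iff_le_add', le_div_iff₀ hK]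
  have := hcount.trans hsumle
  nlinarith

/-- **THE REFRESH-BUDGET DISTANCE FLOOR: `d(n) ≥ 1 − n(1−t)/(K+1) − Σ_k μ_k(s)`** for the scheme with identity maps
on any swap list, any allocation and update kernels, every state `s`. [ours] -/
theorem refreshBudget_worstTvDist_ge (hm : 1 ≤ m) (he : ∀ r, (e r).1 ≠ (e r).2) (hμ : ∀ k x, 0 < μ k x)
    (hμ1 : ∀ k, ∑ u, μ k u = 1) (hM : ∀ k, IsRowStochastic (M k)) (hw0 : ∀ k, 0 ≤ w k) (hw1 : ∑ k, w k = 1)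
    (ht0 : 0 ≤ t) (ht1 : t ≤ 1) (s : S) (n : ℕ) :
    1 - n * (1 - t) / (K + 1) - ∑ k, μ k s
      ≤ worstTvDist (fun y z : Fin (K + 1) → S =>
          t * ptGraphSwap μ e (fun _ => Equiv.refl S) y z + (1 - t) * prodKernel w M y z) (tensorFun μ) n := by
  have hP := weightedScheme_isRowStochastic (t := t) (w := w)
    (ptGraphSwap_isRowStochastic (e := e) (φ := fun _ => Equiv.refl S) hμ) hM hw0 hw1 ht0 ht1
  have hev := scheme_lawAt_event_ge (e := e) (M := M) (w := w) hm he hμ hM hw0 hw1 ht0 ht1 s n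
  have hπA := tensorFun_mass_someKept_le hμ hμ1 (fun _ : Fin (K + 1) => s) (univ : Finset (Fin (K + 1)))
  have hmass : ∑ z, lawAt (fun y z : Fin (K + 1) → S =>
      t * ptGraphSwap μ e (fun _ => Equiv.refl S) y z + (1 - t) * prodKernel w M y z)
      (Pi.single (fun _ : Fin (K + 1) => s) 1) n z = ∑ z, tensorFun μ z := by
    rw [sum_lawAt hP, Finset.sum_pi_single', if_pos (mem_univ _), sum_tensorFun_eq_one μ hμ1]
  have htv := sub_sum_le_tvDist hmass
    (univ.filter (fun z : Fin (K + 1) → S => ∃ k ∈ (univ : Finset (Fin (K + 1))), z k = (fun _ : Fin (K + 1) => s) k))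
  have hw := tvDist_single_le_worstTvDist (fun y z : Fin (K + 1) → S =>
      t * ptGraphSwap μ e (fun _ => Equiv.refl S) y z + (1 - t) * prodKernel w M y z) (tensorFun μ) n
    (fun _ : Fin (K + 1) => s)
  have hπA' : ∑ z ∈ univ.filter (fun z : Fin (K + 1) → S =>
      ∃ k ∈ (univ : Finset (Fin (K + 1))), z k = (fun _ : Fin (K + 1) => s) k), tensorFun μ z ≤ ∑ k, μ k s := hπA
  linarith

/-! ## §5 The refresh-budget floor on the mixing time -/

/-- **THE REFRESH-BUDGET FLOOR:** identity maps, any swap list, allocation, `μ_k`-reversible updates, `0 ≤ t < 1`, the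
scheme `ε`-close to `π̃` at some time: **`t_mix(ε) ≥ (K+1)(1 − ε − Σ_k μ_k(s))/(1−t)`** for every state `s`. [ours] -/
theorem refreshBudget_mixingTime_ge (hm : 1 ≤ m) (he : ∀ r, (e r).1 ≠ (e r).2) (hμ : ∀ k x, 0 < μ k x)
    (hμ1 : ∀ k, ∑ u, μ k u = 1) (hM : ∀ k, IsRowStochastic (M k)) (hMrev : ∀ k, DetailedBalance (μ k) (M k))
    (hw0 : ∀ k, 0 ≤ w k) (hw1 : ∑ k, w k = 1) (ht0 : 0 ≤ t) (ht1 : t < 1) (s : S) {ε : ℝ}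
    (hmix : ∃ t₀, worstTvDist (fun y z : Fin (K + 1) → S =>
      t * ptGraphSwap μ e (fun _ => Equiv.refl S) y z + (1 - t) * prodKernel w M y z) (tensorFun μ) t₀ ≤ ε) :
    ((K : ℝ) + 1) * (1 - ε - ∑ k, μ k s) / (1 - t)
      ≤ (mixingTime (fun y z : Fin (K + 1) → S =>
          t * ptGraphSwap μ e (fun _ => Equiv.refl S) y z + (1 - t) * prodKernel w M y z) (tensorFun μ) ε : ℝ) := by
  set n := mixingTime (fun y z : Fin (K + 1) → S =>
      t * ptGraphSwap μ e (fun _ => Equiv.refl S) y z + (1 - t) * prodKernel w M y z) (tensorFun μ) ε with hn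
  have hP := weightedScheme_isRowStochastic (t := t) (w := w)
    (ptGraphSwap_isRowStochastic (e := e) (φ := fun _ => Equiv.refl S) hμ) hM hw0 hw1 ht0 ht1.le
  have hst := (weightedScheme_detailedBalance (w := w)
    (ptGraphSwap_detailedBalance (e := e) (φ := fun _ => Equiv.refl S) hμ) hMrev t).isStationary hP.2
  obtain ⟨t₀, ht₀⟩ := hmix
  have hd : worstTvDist (fun y z : Fin (K + 1) → S =>
      t * ptGraphSwap μ e (fun _ => Equiv.refl S) y z + (1 - t) * prodKernel w M y z) (tensorFun μ) n ≤ ε :=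
    worstTvDist_le_of_mixingTime_le hP hst ht₀ le_rfl
  have hfloor := refreshBudget_worstTvDist_ge (e := e) (M := M) (w := w) hm he hμ hμ1 hM hw0 hw1 ht0 ht1.le s n
  have h1t : 0 < 1 - t := by linarith
  have hK : (0 : ℝ) < K + 1 := by positivity
  rw [div_le_iff₀ h1t]
  have h3 : 1 - (n : ℝ) * (1 - t) / (K + 1) - ∑ k, μ k s ≤ ε := hfloor.trans hd
  rw [sub_sub, sub_le_iff_le_add] at h3
  have h4 : ((K : ℝ) + 1) * (1 - ε - ∑ k, μ k s) ≤ (n : ℝ) * (1 - t) := by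
    have := mul_le_mul_of_nonneg_left h3 hK.le
    rw [mul_add, mul_add, mul_div_cancel₀ _ hK.ne'] at this
    linarith
  linarith

omit [DecidableEq S] in
/-- **A rare state exists:** some `s` has `Σ_k μ_k(s) ≤ (K+1)/|S|` (averaging). [ours] -/
theorem exists_rare_state (hμ1 : ∀ k, ∑ u, μ k u = 1) [Nonempty S] :
    ∃ s : S, ∑ k, μ k s ≤ ((K : ℝ) + 1) / Fintype.card S := by
  have hcard : (0 : ℝ) < Fintype.card S := Nat.cast_pos.mpr Fintype.card_pos
  have htot : ∑ s, ∑ k, μ k s = (K : ℝ) + 1 := by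
    rw [Finset.sum_comm]
    simp [hμ1]
  obtain ⟨s, -, hs⟩ := Finset.exists_le_of_sum_le (univ_nonempty (α := S)) (f := fun s => ∑ k, μ k s)
    (g := fun _ => ((K : ℝ) + 1) / Fintype.card S)
    (by rw [htot, sum_const, card_univ, nsmul_eq_mul, mul_div_cancel₀ _ hcard.ne'])
  exact ⟨s, hs⟩

/-- **THE QUARTER FORM ON A LARGE CONFIGURATION SPACE (`|S| ≥ 4(K+1)`): `t_mix(1/4) ≥ (K+1)/(2(1−t))`** for the
scheme with identity maps on any swap list, any allocation, reversible updates, `0 ≤ t < 1`, `1/4`-close at some time.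
[ours] -/
theorem refreshBudget_mixingTime_ge_quarter_of_card (hm : 1 ≤ m) (he : ∀ r, (e r).1 ≠ (e r).2)
    (hμ : ∀ k x, 0 < μ k x) (hμ1 : ∀ k, ∑ u, μ k u = 1) (hM : ∀ k, IsRowStochastic (M k))
    (hMrev : ∀ k, DetailedBalance (μ k) (M k)) (hw0 : ∀ k, 0 ≤ w k) (hw1 : ∑ k, w k = 1) (ht0 : 0 ≤ t) (ht1 : t < 1)
    (hS : 4 * (K + 1) ≤ Fintype.card S)
    (hmix : ∃ t₀, worstTvDist (fun y z : Fin (K + 1) → S =>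
      t * ptGraphSwap μ e (fun _ => Equiv.refl S) y z + (1 - t) * prodKernel w M y z) (tensorFun μ) t₀ ≤ 1 / 4) :
    ((K : ℝ) + 1) / (2 * (1 - t))
      ≤ (mixingTime (fun y z : Fin (K + 1) → S =>
          t * ptGraphSwap μ e (fun _ => Equiv.refl S) y z + (1 - t) * prodKernel w M y z) (tensorFun μ) (1 / 4) : ℝ) := by
  have hcardpos : 0 < Fintype.card S := by omega
  haveI : Nonempty S := Fintype.card_pos_iff.mp hcardpos
  obtain ⟨s, hs⟩ := exists_rare_state (μ := μ) hμ1
  have hcard : (0 : ℝ) < Fintype.card S := Nat.cast_pos.mpr hcardpos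
  have hS' : (4 : ℝ) * (K + 1) ≤ Fintype.card S := by exact_mod_cast hS
  have hδ : ∑ k, μ k s ≤ 1 / 4 := by
    refine hs.trans ?_
    rw [div_le_iff₀ hcard]; linarith
  have h := refreshBudget_mixingTime_ge (e := e) (M := M) (w := w) hm he hμ hμ1 hM hMrev hw0 hw1 ht0 ht1 s hmix
  have h1t : 0 < 1 - t := by linarith
  refine le_trans ?_ h
  rw [div_le_div_iff₀ (by positivity) h1t]
  have hK : (0 : ℝ) ≤ K + 1 := by positivity
  nlinarith [mul_nonneg (mul_nonneg hK h1t.le) (sub_nonneg.2 hδ)]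

end Count

end Summit.Ventures.LatticeQCDFlow.Scaling

end
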